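import Summits.MatrixMultiplication.MatrixMultiplication.Theses.BrentRefutationDepth

/-!
# MatrixMultiplication / BrentRefutationDepth — assembly

Route `MatrixMultiplication/BrentRefutationDepth`, assembly item `stmt-MatrixMultiplication-5589`
(`Assembly`, rank 1): `PolyDepthRefutation → RefutationSound → SuperquadraticGap → ¬ MatrixMultiplication`.

Pure logic plus `Nat.le_ceil`: `PolyDepthRefutation` gives `δ > 0`, `C` and, for all large `n`, a
Nullstellensatz refutation of the Brent system `B(n, ⌈n^{2+δ}⌉₊)` with multipliers of degree
`≤ n ^ C`; `RefutationSound` turns each into `⌈n^{2+δ}⌉₊ < R(⟨n,n,n⟩)`, so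
`(n : ℝ)^{2+δ} ≤ ⌈n^{2+δ}⌉₊ ≤ R(⟨n,n,n⟩)` eventually, which is the hypothesis of `SuperquadraticGap`,
whose conclusion is `¬ MatrixMultiplication`. (Same argument as the route's deciding theorem `closes`.)

Not here: any of the three hypotheses (the route's target, and the two provable-now support items,
of which `RefutationSound` is `Theorems/BrentRefutationDepthRefutationSound.lean` and
`SuperquadraticGap` is `Theorems/BrentRefutationDepthSuperquadraticGap.lean`).
-/

-- `Summit.<Summit>.<Problem>` is the tree's mandated summit-side namespace; for this
-- single-conjunct summit the two coincide, so the file silences `dupNamespace`.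
set_option linter.dupNamespace false

namespace Summit.MatrixMultiplication.MatrixMultiplication.Theorems

open Summit.MatrixMultiplication.MatrixMultiplication.Theses.BrentRefutationDepth

/-- Settles `stmt-MatrixMultiplication-5589` (`Assembly`, route BrentRefutationDepth):
`PolyDepthRefutation → RefutationSound → SuperquadraticGap → ¬ MatrixMultiplication`.
From `PolyDepthRefutation` take `δ > 0`, `C` and the eventual refutations; `RefutationSound` gives
`⌈n^{2+δ}⌉₊ < R(⟨n,n,n⟩)` for all large `n`, hence `(n:ℝ)^{2+δ} ≤ R(⟨n,n,n⟩)` eventually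
(`Nat.le_ceil`), and `SuperquadraticGap` concludes `¬ MatrixMultiplication`. -/
theorem assembly_proof :
    Summit.MatrixMultiplication.MatrixMultiplication.Theses.BrentRefutationDepth.Assembly := by
  unfold Assembly
  intro hX hS hG
  obtain ⟨δ, hδ, C, hev⟩ := hX
  refine hG ⟨δ, hδ, ?_⟩
  filter_upwards [hev] with n hn
  have hlt := hS n ⌈(n : ℝ) ^ (2 + δ)⌉₊ (n ^ C) hn
  calc (n : ℝ) ^ (2 + δ) ≤ (⌈(n : ℝ) ^ (2 + δ)⌉₊ : ℝ) := Nat.le_ceil _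
    _ ≤ _ := by exact_mod_cast hlt.le

end Summit.MatrixMultiplication.MatrixMultiplication.Theorems
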